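import Summits.AtomisticToContinuum.FouriersLaw.Theorems.OddSectorIrreversibilityResponseDensityBackwardMain
import Literature.MathematicalPhysics.KineticTheory.LangevinSemigroupProofs

/-!
# The exact response identity of the pinned chain at finite temperature difference

Helper file for item stmt-AtomisticToContinuum-9144 (`ResponseDensity`, route
`OddSectorIrreversibility`, sub-problem `FouriersLaw` of `AtomisticToContinuum`).

For `pinnedChain ω₂ lam β γ` (`ω₂, β, γ > 0`, `lam ≥ 0`, `N ≥ 1`) between baths at
`T_L = T + δ/2`, `T_R = T - δ/2` (both positive), the Gibbs weight `e^{-H/T}` at the MEAN temperature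
satisfies `Lᵀ e^{-H/T} = δ · (γ/2T²) · (p_0² - p_{N-1}²) e^{-H/T}` (`Lᵀ` the Lebesgue transpose of the
generator). Feeding this into the backward identity (`…ResponseDensityBackwardMain.lean`) gives, for
every `φ ∈ C²` with `|φ| ≤ C e^{ϑH}` (`0 < ϑ < 1/max(T_L,T_R)`) and every `t ≥ 0`, the finite-time
response identity

  `∫ e^{-H/T} P_t φ dx - ∫ e^{-H/T} φ dx = δ (γ/2T²) ∫₀ᵗ ∫ P_s φ · (p_0² - p_{N-1}²) e^{-H/T} dx ds`

(`pinnedChain_finite_time_response_identity`). No definitions.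
-/

noncomputable section

open MeasureTheory ProbabilityTheory Filter Topology Set
open scoped NNReal ENNReal ContDiff

namespace Summit.AtomisticToContinuum.FouriersLaw.Theorems

open Literature.MathematicalPhysics.KineticTheory.HeatConduction
open Literature.Probability.Process Literature.MathematicalPhysics.KineticTheory OscillatorChain

variable {N : ℕ}

/-- The algebra of the transposed generator on the mean-temperature Gibbs weight: with `θ = -1/T`,
`T_L = T + δ/2`, `T_R = T - δ/2`,
`γ (T_L(θ²p_0² + θ) + θp_0² + T_R(θ²p_l² + θ) + θp_l²) = -2γ + δ (γ/(2T²)) (p_0² - p_l²)`. -/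
theorem response_weight_algebra {T : ℝ} (hT : T ≠ 0) (γ δ p q : ℝ) :
    γ * ((T + δ / 2) * ((-1 / T) ^ 2 * p ^ 2 + -1 / T) + -1 / T * p ^ 2 +
        ((T - δ / 2) * ((-1 / T) ^ 2 * q ^ 2 + -1 / T) + -1 / T * q ^ 2)) =
      -(2 * γ) + δ * (γ / (2 * T ^ 2)) * (p ^ 2 - q ^ 2) := by
  field_simp
  ring

/-- `max(T + δ/2, T - δ/2) ≥ T`, hence `ϑ < 1/max ⟹ -1/T + ϑ < 0` (`T > 0`). -/
theorem neg_inv_add_lt_zero {T δ ϑ : ℝ} (hT : 0 < T) (hϑ' : ϑ < 1 / max (T + δ / 2) (T - δ / 2)) :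
    -1 / T + ϑ < 0 := by
  have hmax : T ≤ max (T + δ / 2) (T - δ / 2) := by
    rcases le_or_gt 0 δ with h | h
    · exact le_max_of_le_left (by linarith)
    · exact le_max_of_le_right (by linarith)
  have h1 : 1 / max (T + δ / 2) (T - δ / 2) ≤ 1 / T := one_div_le_one_div_of_le hT hmax
  have h2 : ϑ < 1 / T := hϑ'.trans_le h1
  have h3 : -1 / T + ϑ = ϑ - 1 / T := by ring
  rw [h3]
  linarith

section Kernel

variable {ω₂ lam β γ : ℝ} (hω : 0 < ω₂) (hl : 0 ≤ lam) (hβ : 0 ≤ β) (hγ : 0 ≤ γ) (N : ℕ)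
  (T_L T_R : ℝ)
include hω hl hβ hγ

/-- Joint measurability of the forecast `(t, x) ↦ P_t φ(x)` for a strongly measurable `φ`. -/
theorem pinnedChain_measurable_integral_kernel_uncurry {φ : PhaseSpace N → ℝ}
    (hφm : StronglyMeasurable φ) :
    Measurable fun p : ℝ≥0 × PhaseSpace N =>
      ∫ y, φ y ∂((pinnedChain ω₂ lam β γ).transitionKernel N T_L T_R p.1 p.2) := by
  let κ : Kernel (ℝ≥0 × PhaseSpace N) (PhaseSpace N) :=
    ⟨fun p => (pinnedChain ω₂ lam β γ).transitionKernel N T_L T_R p.1 p.2,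
      pinnedChain_measurable_transitionKernel hω hl hβ hγ N T_L T_R⟩
  exact (hφm.integral_kernel (κ := κ)).measurable

omit hω hl hβ hγ in
/-- Measurability of the forecast `x ↦ P_t φ(x)` for a strongly measurable `φ`. -/
theorem pinnedChain_measurable_integral_kernel {φ : PhaseSpace N → ℝ} (hφm : StronglyMeasurable φ)
    (t : ℝ≥0) :
    Measurable fun x : PhaseSpace N =>
      ∫ y, φ y ∂((pinnedChain ω₂ lam β γ).transitionKernel N T_L T_R t x) :=
  (hφm.integral_kernel (κ := (pinnedChain ω₂ lam β γ).transitionKernel N T_L T_R t)).measurable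

end Kernel

section FiniteTime

variable {ω₂ lam β γ : ℝ} (hω : 0 < ω₂) (hl : 0 ≤ lam) (hβ : 0 ≤ β) (hγ : 0 < γ)
  (hN : 0 < N) {T δ : ℝ} (hT : 0 < T) (hTL : 0 < T + δ / 2) (hTR : 0 < T - δ / 2)
  {ϑ : ℝ} (hϑ : 0 < ϑ) (hϑ' : ϑ < 1 / max (T + δ / 2) (T - δ / 2))
  {φ : PhaseSpace N → ℝ} (hφ2 : ContDiff ℝ 2 φ) {C : ℝ}
  (hφ : ∀ y, |φ y| ≤ C * Real.exp (ϑ * (pinnedChain ω₂ lam β γ).hamiltonian N y))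
include hω hl hβ hγ hN hT hTL hTR hϑ hϑ' hφ2 hφ

/-- The Gibbs-weighted forecast `x ↦ e^{-H(x)/T} P_s φ(x)` is Lebesgue integrable. -/
theorem integrable_gibbsWeight_mul_forecast (s : ℝ≥0) :
    Integrable fun x : PhaseSpace N =>
      Real.exp (-1 / T * (pinnedChain ω₂ lam β γ).hamiltonian N x) *
        ∫ y, φ y ∂((pinnedChain ω₂ lam β γ).transitionKernel N (T + δ / 2) (T - δ / 2) s x) := by
  have hθϑ := neg_inv_add_lt_zero hT hϑ' (δ := δ)
  have hHc : Continuous ((pinnedChain ω₂ lam β γ).hamiltonian N) :=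
    (pinnedChain_contDiff_hamiltonian ω₂ lam β γ N (n := 0)).continuous
  have hmeas : AEStronglyMeasurable (fun x : PhaseSpace N =>
      Real.exp (-1 / T * (pinnedChain ω₂ lam β γ).hamiltonian N x) *
        ∫ y, φ y ∂((pinnedChain ω₂ lam β γ).transitionKernel N (T + δ / 2) (T - δ / 2) s x)) volume :=
    ((Real.continuous_exp.comp (continuous_const.mul hHc)).measurable.mul
      (pinnedChain_measurable_integral_kernel N _ _ hφ2.continuous.stronglyMeasurable
        s)).aestronglyMeasurable
  refine ((integrable_exp_mul_hamiltonian hω hl hβ γ hθϑ).const_mul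
    (C * Real.exp (ϑ * γ * (T + δ / 2 + (T - δ / 2)) * s))).mono' hmeas (Eventually.of_forall fun x => ?_)
  have hb := pinnedChain_abs_integral_kernel_le' hω hl hβ hγ hN hTL hTR hϑ hϑ' hφ s x
  rw [Real.norm_eq_abs, abs_mul, abs_of_pos (Real.exp_pos _),
    show (-1 / T + ϑ) * (pinnedChain ω₂ lam β γ).hamiltonian N x =
      -1 / T * (pinnedChain ω₂ lam β γ).hamiltonian N x + ϑ * (pinnedChain ω₂ lam β γ).hamiltonian N x
      by ring, Real.exp_add]
  calc _ ≤ Real.exp (-1 / T * (pinnedChain ω₂ lam β γ).hamiltonian N x) *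
        (C * (Real.exp (ϑ * γ * (T + δ / 2 + (T - δ / 2)) * s) *
          Real.exp (ϑ * (pinnedChain ω₂ lam β γ).hamiltonian N x))) :=
        mul_le_mul_of_nonneg_left hb (Real.exp_pos _).le
    _ = _ := by ring

/-- The forecast against the odd Gibbs moment `x ↦ P_s φ(x) · (e^{-H(x)/T} (p_0² - p_{N-1}²))` is
Lebesgue integrable. -/
theorem integrable_forecast_mul_oddMoment (s : ℝ≥0) :
    Integrable fun x : PhaseSpace N =>
      (∫ y, φ y ∂((pinnedChain ω₂ lam β γ).transitionKernel N (T + δ / 2) (T - δ / 2) s x)) *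
        (Real.exp (-1 / T * (pinnedChain ω₂ lam β γ).hamiltonian N x) *
          (x.2 ⟨0, hN⟩ ^ 2 - x.2 ⟨N - 1, by omega⟩ ^ 2)) := by
  have hθϑ := neg_inv_add_lt_zero hT hϑ' (δ := δ)
  have hHc : Continuous ((pinnedChain ω₂ lam β γ).hamiltonian N) :=
    (pinnedChain_contDiff_hamiltonian ω₂ lam β γ N (n := 0)).continuous
  have hC : 0 ≤ C := by
    have := (abs_nonneg _).trans (hφ 0)
    exact nonneg_of_mul_nonneg_left this (Real.exp_pos _)
  have hw : Continuous fun x : PhaseSpace N =>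
      Real.exp (-1 / T * (pinnedChain ω₂ lam β γ).hamiltonian N x) *
        (x.2 ⟨0, hN⟩ ^ 2 - x.2 ⟨N - 1, by omega⟩ ^ 2) :=
    (Real.continuous_exp.comp (continuous_const.mul hHc)).mul
      ((((continuous_apply _).comp continuous_snd).pow 2).sub
        (((continuous_apply _).comp continuous_snd).pow 2))
  have hmeas : AEStronglyMeasurable (fun x : PhaseSpace N =>
      (∫ y, φ y ∂((pinnedChain ω₂ lam β γ).transitionKernel N (T + δ / 2) (T - δ / 2) s x)) *
        (Real.exp (-1 / T * (pinnedChain ω₂ lam β γ).hamiltonian N x) *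
          (x.2 ⟨0, hN⟩ ^ 2 - x.2 ⟨N - 1, by omega⟩ ^ 2))) volume :=
    ((pinnedChain_measurable_integral_kernel N _ _ hφ2.continuous.stronglyMeasurable
      s).mul hw.measurable).aestronglyMeasurable
  refine ((integrable_momentSq_mul_exp_mul_hamiltonian hω hl hβ γ hN hθϑ).const_mul
    (C * Real.exp (ϑ * γ * (T + δ / 2 + (T - δ / 2)) * s))).mono' hmeas
    (Eventually.of_forall fun x => ?_)
  have hb := pinnedChain_abs_integral_kernel_le' hω hl hβ hγ hN hTL hTR hϑ hϑ' hφ s x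
  have hp : |x.2 ⟨0, hN⟩ ^ 2 - x.2 ⟨N - 1, by omega⟩ ^ 2| ≤
      1 + x.2 ⟨0, hN⟩ ^ 2 + x.2 ⟨N - 1, by omega⟩ ^ 2 := by
    have h1 : 0 ≤ x.2 ⟨0, hN⟩ ^ 2 := sq_nonneg _
    have h2 : 0 ≤ x.2 ⟨N - 1, by omega⟩ ^ 2 := sq_nonneg _
    rw [abs_le]
    constructor <;> linarith
  rw [Real.norm_eq_abs, abs_mul, abs_mul, abs_of_pos (Real.exp_pos _),
    show (-1 / T + ϑ) * (pinnedChain ω₂ lam β γ).hamiltonian N x =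
      -1 / T * (pinnedChain ω₂ lam β γ).hamiltonian N x + ϑ * (pinnedChain ω₂ lam β γ).hamiltonian N x
      by ring, Real.exp_add]
  have hE1 := (Real.exp_pos (-1 / T * (pinnedChain ω₂ lam β γ).hamiltonian N x)).le
  have hE2 := (Real.exp_pos (ϑ * (pinnedChain ω₂ lam β γ).hamiltonian N x)).le
  have hE3 := (Real.exp_pos (ϑ * γ * (T + δ / 2 + (T - δ / 2)) * s)).le
  calc |∫ y, φ y ∂((pinnedChain ω₂ lam β γ).transitionKernel N (T + δ / 2) (T - δ / 2) s x)| *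
        (Real.exp (-1 / T * (pinnedChain ω₂ lam β γ).hamiltonian N x) *
          |x.2 ⟨0, hN⟩ ^ 2 - x.2 ⟨N - 1, by omega⟩ ^ 2|)
      ≤ (C * (Real.exp (ϑ * γ * (T + δ / 2 + (T - δ / 2)) * s) *
          Real.exp (ϑ * (pinnedChain ω₂ lam β γ).hamiltonian N x))) *
        (Real.exp (-1 / T * (pinnedChain ω₂ lam β γ).hamiltonian N x) *
          (1 + x.2 ⟨0, hN⟩ ^ 2 + x.2 ⟨N - 1, by omega⟩ ^ 2)) :=
        mul_le_mul hb (mul_le_mul_of_nonneg_left hp hE1) (by positivity) (by positivity)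
    _ = _ := by ring

/-- **The finite-time response identity of the pinned chain.** With baths at `T ± δ/2` and the
Gibbs weight at the mean temperature `T`, for every `t ≥ 0`:
`∫ e^{-H/T} P_t φ dx - ∫ e^{-H/T} φ dx = δ (γ/2T²) ∫₀ᵗ ∫ P_s φ · e^{-H/T} (p_0² - p_{N-1}²) dx ds`. -/
theorem pinnedChain_finite_time_response_identity (t : ℝ≥0) :
    (∫ x, Real.exp (-1 / T * (pinnedChain ω₂ lam β γ).hamiltonian N x) *
        ∫ y, φ y ∂((pinnedChain ω₂ lam β γ).transitionKernel N (T + δ / 2) (T - δ / 2) t x)) -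
      ∫ x, Real.exp (-1 / T * (pinnedChain ω₂ lam β γ).hamiltonian N x) * φ x =
      δ * (γ / (2 * T ^ 2)) * ∫ s in (0 : ℝ)..t,
        ∫ x, (∫ y, φ y ∂((pinnedChain ω₂ lam β γ).transitionKernel N (T + δ / 2) (T - δ / 2)
            s.toNNReal x)) *
          (Real.exp (-1 / T * (pinnedChain ω₂ lam β γ).hamiltonian N x) *
            (x.2 ⟨0, hN⟩ ^ 2 - x.2 ⟨N - 1, by omega⟩ ^ 2)) := by
  have hθϑ := neg_inv_add_lt_zero hT hϑ' (δ := δ)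
  have hid := pinnedChain_gibbs_backward_identity_integral hω hl hβ hγ hN hTL hTR hϑ hϑ' hθϑ hφ2 hφ t
  rw [hid, ← intervalIntegral.integral_const_mul]
  refine intervalIntegral.integral_congr fun s _ => ?_
  have hI1 := integrable_gibbsWeight_mul_forecast hω hl hβ hγ hN hT hTL hTR hϑ hϑ' hφ2 hφ s.toNNReal
  have hI2 := integrable_forecast_mul_oddMoment hω hl hβ hγ hN hT hTL hTR hϑ hϑ' hφ2 hφ s.toNNReal
  -- rewrite the weight `γ(...)` as `-2γ + δ c (p_0² - p_l²)` pointwise and split the integral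
  have hw : ∀ x : PhaseSpace N,
      (∫ y, φ y ∂((pinnedChain ω₂ lam β γ).transitionKernel N (T + δ / 2) (T - δ / 2) s.toNNReal x)) *
        (Real.exp (-1 / T * (pinnedChain ω₂ lam β γ).hamiltonian N x) *
          (γ * ((T + δ / 2) * ((-1 / T) ^ 2 * x.2 ⟨0, hN⟩ ^ 2 + -1 / T) + -1 / T * x.2 ⟨0, hN⟩ ^ 2 +
            ((T - δ / 2) * ((-1 / T) ^ 2 * x.2 ⟨N - 1, by omega⟩ ^ 2 + -1 / T) +
              -1 / T * x.2 ⟨N - 1, by omega⟩ ^ 2)))) =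
      -(2 * γ) * (Real.exp (-1 / T * (pinnedChain ω₂ lam β γ).hamiltonian N x) *
          ∫ y, φ y ∂((pinnedChain ω₂ lam β γ).transitionKernel N (T + δ / 2) (T - δ / 2) s.toNNReal x)) +
        δ * (γ / (2 * T ^ 2)) *
          ((∫ y, φ y ∂((pinnedChain ω₂ lam β γ).transitionKernel N (T + δ / 2) (T - δ / 2) s.toNNReal x)) *
            (Real.exp (-1 / T * (pinnedChain ω₂ lam β γ).hamiltonian N x) *
              (x.2 ⟨0, hN⟩ ^ 2 - x.2 ⟨N - 1, by omega⟩ ^ 2))) := by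
    intro x
    rw [response_weight_algebra hT.ne' γ δ]
    ring
  simp_rw [hw]
  rw [integral_add (hI1.const_mul _) (hI2.const_mul _), integral_const_mul, integral_const_mul]
  ring


omit hT hTL hTR hϑ hϑ' hφ in
/-- **Measurability in time of the odd-moment pairing** `s ↦ ∫ P_s φ · e^{-H/T}(p_0² - p_{N-1}²) dx`
(Fubini measurability from the joint measurability of the transition kernels). -/
theorem measurable_oddMoment_pairing :
    Measurable fun s : ℝ =>
      ∫ x, (∫ y, φ y ∂((pinnedChain ω₂ lam β γ).transitionKernel N (T + δ / 2) (T - δ / 2)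
          s.toNNReal x)) *
        (Real.exp (-1 / T * (pinnedChain ω₂ lam β γ).hamiltonian N x) *
          (x.2 ⟨0, hN⟩ ^ 2 - x.2 ⟨N - 1, by omega⟩ ^ 2)) := by
  have hHc : Continuous ((pinnedChain ω₂ lam β γ).hamiltonian N) :=
    (pinnedChain_contDiff_hamiltonian ω₂ lam β γ N (n := 0)).continuous
  have hw : Continuous fun x : PhaseSpace N =>
      Real.exp (-1 / T * (pinnedChain ω₂ lam β γ).hamiltonian N x) *
        (x.2 ⟨0, hN⟩ ^ 2 - x.2 ⟨N - 1, by omega⟩ ^ 2) :=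
    (Real.continuous_exp.comp (continuous_const.mul hHc)).mul
      ((((continuous_apply _).comp continuous_snd).pow 2).sub
        (((continuous_apply _).comp continuous_snd).pow 2))
  have h1 := pinnedChain_measurable_integral_kernel_uncurry hω hl hβ hγ.le N (T + δ / 2) (T - δ / 2)
    hφ2.continuous.stronglyMeasurable
  have h2 : Measurable fun p : ℝ × PhaseSpace N => (p.1.toNNReal, p.2) :=
    (measurable_real_toNNReal.comp measurable_fst).prodMk measurable_snd
  have hf : Measurable fun p : ℝ × PhaseSpace N =>
      (∫ y, φ y ∂((pinnedChain ω₂ lam β γ).transitionKernel N (T + δ / 2) (T - δ / 2)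
          p.1.toNNReal p.2)) *
        (Real.exp (-1 / T * (pinnedChain ω₂ lam β γ).hamiltonian N p.2) *
          (p.2.2 ⟨0, hN⟩ ^ 2 - p.2.2 ⟨N - 1, by omega⟩ ^ 2)) :=
    (h1.comp h2).mul (hw.measurable.comp measurable_snd)
  exact (hf.stronglyMeasurable.integral_prod_right' (ν := volume)).measurable

omit hφ2 hφ in
/-- **The odd Gibbs moment vanishes**: `∫ e^{-H/T} (p_0² - p_{N-1}²) dx = 0` — obtained from the
finite-time response identity with `φ ≡ 1` (`δ ≠ 0`): the left-hand side vanishes since `P_t 1 = 1`,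
the right-hand side is `δ (γ/2T²) t ∫ e^{-H/T}(p_0² - p_{N-1}²) dx`. -/
theorem integral_gibbsWeight_oddMoment_eq_zero (hδ : δ ≠ 0) :
    ∫ x : PhaseSpace N, Real.exp (-1 / T * (pinnedChain ω₂ lam β γ).hamiltonian N x) *
        (x.2 ⟨0, hN⟩ ^ 2 - x.2 ⟨N - 1, by omega⟩ ^ 2) = 0 := by
  haveI := fun t => pinnedChain_isMarkovKernel_transitionKernel hω hl hβ hγ.le N (T + δ / 2) (T - δ / 2) t
  have hone : ∀ y : PhaseSpace N, |(fun _ : PhaseSpace N => (1 : ℝ)) y| ≤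
      1 * Real.exp (ϑ * (pinnedChain ω₂ lam β γ).hamiltonian N y) := fun y => by
    simp only [abs_one, one_mul]
    exact Real.one_le_exp (mul_nonneg hϑ.le (pinnedChain_hamiltonian_nonneg hω.le hl hβ γ N y))
  have h := pinnedChain_finite_time_response_identity hω hl hβ hγ hN hT hTL hTR hϑ hϑ'
    (contDiff_const (c := (1 : ℝ))) hone 1
  have hK1 : ∀ (t : ℝ≥0) (x : PhaseSpace N),
      ∫ _y, (1 : ℝ) ∂((pinnedChain ω₂ lam β γ).transitionKernel N (T + δ / 2) (T - δ / 2) t x) = 1 :=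
    fun t x => by simp
  simp_rw [hK1] at h
  simp only [mul_one, one_mul, sub_self, NNReal.coe_one] at h
  rw [intervalIntegral.integral_const, sub_zero, one_smul] at h
  have hc : δ * (γ / (2 * T ^ 2)) ≠ 0 := mul_ne_zero hδ (by positivity)
  exact (mul_eq_zero.1 h.symm).resolve_left hc

end FiniteTime

end Summit.AtomisticToContinuum.FouriersLaw.Theorems

end
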